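import Summits.Ventures.YMGap.RobustBall.RowsSUN
import Summits.Ventures.YMGap.RobustBall.RowsSU3Certified
import HarnessLib

/-!
# Venture YMGap, track Y2 ROBUST-BALL — HYPOTHESIS-FREE `SU(3)` rows of the `ℤ⁴` single-link ball theorem (the class-K baseline under
# `RowsSU3Certified`): p2's all-`N` Bakry–Émery pair door at `N = 3`

HONEST FRAMING.  Venture file of the cell `pub-ymgap` (QuantumFields programme), seat engine-2 (g6).  Strong-coupling LATTICE statements only
(`SU(3)` lattice Yang–Mills on `ℤ⁴` plus a link perturbation in the tier-1 ball; 't Hooft coupling `β_W/9`): `MassGapOnBallZd 4 3 (β_W/9) (2ε) ε R`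
= every member has a unique, exponentially clustering DLR state, for every range `R`.  Nothing about the continuum, weak coupling, or Clay.
HYPOTHESIS-FREE (class K): kernel arithmetic over p2's `RobustBallSUN.suN_massGapOnBallZd_bakryEmery_dim4` (every `N ≥ 2`; row value
`18|β|e^{ε₀}/(1/2 − 6|β|) + e^{ε₀/2}ε₁/√(N(1/2 − 6|β|))`) at `N = 3`, i.e. in Wilson units `ρ = 2β_W e^{2ε}/(1/2 − 2β_W/3) + e^{ε}ε/√(3(1/2 − 2β_W/3))`,
certified with `e^x ≤ T(x) = 1 + x + x²/2 + x³/6 + (5/96)x⁴` and a rational majorant `s₀ ≥ 1/√(3(1/2 − 2β_W/3))`.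
ROWS (class K): `(β⋆_W, ε) = (1/10, .23) (1/8, .16) (1/6, .05)` (Wilson threshold of this door `β_W = 3/16`, Shen–Zhu–Zhu's) — versus the rows ON
THE CERTIFIED PAIR (`RowsSU3Certified`, class K × C…): `(1/10, .347) (1/8, .299) (1/6, .230)`, threshold `5/14`.  What the certificates buy.
-/

noncomputable section

open MeasureTheory ProbabilityTheory Real
open Summit.Ventures.YMGap.RobustBall (MassGapOnBallZd)
open Summit.Ventures.YMGap.RobustBallSUN (suN_massGapOnBallZd_bakryEmery_dim4)

namespace Summit.Ventures.YMGap.RobustBallSU3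

/-- **HYPOTHESIS-FREE `SU(3)`, `d = 4`, `ℤ⁴` ball row schema** (Bakry–Émery pair, p2's all-`N` door at `N = 3`): `0 ≤ β_W < 3/4`, `0 ≤ ε ≤ 1/2`,
a rational `s₀ ≥ 0` with `s₀²·3(1/2 − 2β_W/3) ≥ 1`, and the certificate `T(2ε)·2β_W/(1/2 − 2β_W/3) + T(ε)·ε·s₀ < 1` give
`MassGapOnBallZd 4 3 (β_W/9) (2ε) ε R`. [cite: arXiv220412737, Lemma 4.1 and Rem. 1.3] -/
theorem su3_freeZdRow (R : ℝ) {βW ε s₀ : ℝ} (hβ0 : 0 ≤ βW) (hβ : βW < 3 / 4) (hε0 : 0 ≤ ε) (hε1 : ε ≤ 1 / 2) (hs0 : 0 ≤ s₀)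
    (hs : 1 ≤ s₀ ^ 2 * (3 * (1 / 2 - 2 * βW / 3)))
    (hcert : (1 + 2 * ε + (2 * ε) ^ 2 / 2 + (2 * ε) ^ 3 / 6 + 5 / 96 * (2 * ε) ^ 4) * (2 * βW / (1 / 2 - 2 * βW / 3)) +
      (1 + ε + ε ^ 2 / 2 + ε ^ 3 / 6 + 5 / 96 * ε ^ 4) * ε * s₀ < 1) :
    MassGapOnBallZd 4 3 (βW / 9) (2 * ε) ε R := by
  have habs : |βW / 9| = βW / 9 := abs_of_nonneg (by positivity)
  have hden : 0 < 1 / 2 - 2 * βW / 3 := by linarith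
  have h3 : ((3 : ℕ) : ℝ) = 3 := by norm_num
  refine suN_massGapOnBallZd_bakryEmery_dim4 (N := 3) (by norm_num) R (by rw [habs]; linarith) ?_
  rw [habs, h3, show 2 * ε / 2 = ε by ring, show 6 * (βW / 9) = 2 * βW / 3 by ring]
  -- the square-root factor: `1/√(3(1/2 − 2β_W/3)) ≤ s₀`
  have hq : 0 < 3 * (1 / 2 - 2 * βW / 3) := by linarith
  have hsqrt : 0 < Real.sqrt (3 * (1 / 2 - 2 * βW / 3)) := Real.sqrt_pos.2 hq
  have hinv : 1 / Real.sqrt (3 * (1 / 2 - 2 * βW / 3)) ≤ s₀ := by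
    rw [div_le_iff₀ hsqrt]
    have h1 : 1 ≤ s₀ * Real.sqrt (3 * (1 / 2 - 2 * βW / 3)) := by
      have hsq : (s₀ * Real.sqrt (3 * (1 / 2 - 2 * βW / 3))) ^ 2 = s₀ ^ 2 * (3 * (1 / 2 - 2 * βW / 3)) := by
        rw [mul_pow, Real.sq_sqrt hq.le]
      nlinarith [mul_nonneg hs0 hsqrt.le]
    linarith
  have hT2 := exp_le_taylor4 (x := 2 * ε) (by linarith) (by linarith)
  have hT1 := exp_le_taylor4 (x := ε) hε0 (by linarith)
  have hA : 18 * (βW / 9) * exp (2 * ε) / (1 / 2 - 2 * βW / 3) ≤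
      (1 + 2 * ε + (2 * ε) ^ 2 / 2 + (2 * ε) ^ 3 / 6 + 5 / 96 * (2 * ε) ^ 4) * (2 * βW / (1 / 2 - 2 * βW / 3)) := by
    rw [show 18 * (βW / 9) * exp (2 * ε) / (1 / 2 - 2 * βW / 3) = exp (2 * ε) * (2 * βW / (1 / 2 - 2 * βW / 3)) by ring]
    exact mul_le_mul_of_nonneg_right hT2 (by positivity)
  have hB : exp ε * ε / Real.sqrt (3 * (1 / 2 - 2 * βW / 3)) ≤ (1 + ε + ε ^ 2 / 2 + ε ^ 3 / 6 + 5 / 96 * ε ^ 4) * ε * s₀ := by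
    rw [show exp ε * ε / Real.sqrt (3 * (1 / 2 - 2 * βW / 3)) = exp ε * ε * (1 / Real.sqrt (3 * (1 / 2 - 2 * βW / 3))) by ring]
    exact mul_le_mul (mul_le_mul_of_nonneg_right hT1 hε0) hinv (by positivity) (by positivity)
  linarith

/-- HYPOTHESIS-FREE `SU(3)`, `d = 4`: `(β⋆_W, ε) = (1/10, 0.23)` — `MassGapOnBallZd 4 3 ((1/10)/9) 0.46 0.23 R` (class K; on the certified pair: `0.347`). [folklore] -/
theorem su3_freeZdRow_1_10 (R : ℝ) : MassGapOnBallZd 4 3 ((1 / 10 : ℝ) / 9) (2 * (23 / 100)) (23 / 100) R :=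
  su3_freeZdRow R (s₀ := 8771 / 10000) (by norm_num) (by norm_num) (by norm_num) (by norm_num) (by norm_num) (by norm_num) (by norm_num)

/-- HYPOTHESIS-FREE `SU(3)`, `d = 4`: `(1/8, 0.16)` (class K; on the certified pair: `0.299`). [folklore] -/
theorem su3_freeZdRow_1_8 (R : ℝ) : MassGapOnBallZd 4 3 ((1 / 8 : ℝ) / 9) (2 * (4 / 25)) (4 / 25) R :=
  su3_freeZdRow R (s₀ := 8945 / 10000) (by norm_num) (by norm_num) (by norm_num) (by norm_num) (by norm_num) (by norm_num) (by norm_num)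

/-- HYPOTHESIS-FREE `SU(3)`, `d = 4`: `(1/6, 0.05)` (class K; on the certified pair: `0.230`). [folklore] -/
theorem su3_freeZdRow_1_6 (R : ℝ) : MassGapOnBallZd 4 3 ((1 / 6 : ℝ) / 9) (2 * (1 / 20)) (1 / 20) R :=
  su3_freeZdRow R (s₀ := 9259 / 10000) (by norm_num) (by norm_num) (by norm_num) (by norm_num) (by norm_num) (by norm_num) (by norm_num)

/-- Numbers: the door's Wilson threshold `2β_W/(1/2 − 2β_W/3) = 1` at `β_W = 3/16` (Shen–Zhu–Zhu's `SU(N)` value in Wilson units for `N = 3`);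
the square-root majorants `0.8771² · 1.3 ≥ 1`, `0.8945² · 1.25 ≥ 1`, `0.9259² · (7/6) ≥ 1`. [folklore] -/
theorem su3_freeZdRows_numbers :
    (2 : ℝ) * (3 / 16) / (1 / 2 - 2 * (3 / 16) / 3) = 1 ∧ (1 : ℝ) ≤ 0.8771 ^ 2 * 1.3 ∧ (1 : ℝ) ≤ 0.8945 ^ 2 * 1.25 ∧
      (1 : ℝ) ≤ 0.9259 ^ 2 * (7 / 6) := by
  norm_num

end Summit.Ventures.YMGap.RobustBallSU3

end
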